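import Summits.AtomisticToContinuum.BoseEinsteinCondensation.Theorems.BECSwapNoCatastropheTorusHalfSwapOverlapAbsHardLayerPBasics
import Literature.MathematicalPhysics.QuantumManyBody.PeriodicMaxFormBoundHardCore
import Literature.MathematicalPhysics.QuantumManyBody.PeriodicWeightedMaxFormGroundStates
import HarnessLib

/-!
# Crux `TorusHalfSwapOverlap`, line `registered` (v8, truncation split, chain H): stub F `stub_pairFinal`

Route `BECSwapNoCatastrophe`, crux `TorusHalfSwapOverlap` (stmt-AtomisticToContinuum-14393). The final link of the
pair-profile hard-core chain H — the maximal-form bound on the ABSOLUTE (symmetry-free) class for a PAIR-DEPENDENT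
profile matrix `V i j` (hard cores / non-integrable singularities allowed pair by pair). This file is the
pair-profile twin of `Literature/MathematicalPhysics/QuantumManyBody/PeriodicMaxFormBoundHardCore.lean` under the
dictionary `hardLayer v L s ↦ hardLayerP V L s`, `periodicInteraction v L ↦ pairInteraction V L`,
`periodicGroundStateEnergy v N L ↦ absGroundStateEnergyW (pairInteraction V L) L`, Bose symmetry of states deleted.

The registered statements of the two neighbour stubs it consumes are taken as hypotheses:
* Z (`hZ`): the mass of an essentially bounded function with ACL line representatives of locally finite line
  energy in the pair-profile hard layer of width `s` is `o(s²)` (twin of `exists_setLIntegral_hardLayer_le`);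
* S (`hS`): the cut-off step `E₀ᴬ(W_V) (‖ζ‖² - ε) ≤ (1 + ε) maxFormW W_V L ζ + ε` for essentially bounded classes
  with hard-layer decay (twin of `periodicGroundStateEnergy_mul_le_maxForm_step`), `W_V = pairInteraction V L`.
From them, for `L > 0`, a symmetric matrix `V` of repulsive finite-range profiles and EVERY `η ∈ L²((ℝ/ℤ)^{3N})`,

  `absGroundStateEnergyW (pairInteraction V L) L · ‖η‖² ≤ maxFormW (pairInteraction V L) L η`:

* `pairFinal_hardLayerP_decay_of_bound` — bounded finite-energy classes have pair-profile hard-layer decay (ACL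
  representatives `Torus.exists_lineACL_repr`, local finiteness of the line energies `Torus.ae_lintegral_line_lt_top`,
  a common range bound for the hard radii of all pairs, then Z; twin of `hardLayer_decay_of_bound`);
* `pairFinal_mul_le_maxFormW_of_bound` — the bound for bounded classes (S for every `ε`, then `ε → 0` by
  `HardLayerAux.mul_ofReal_le_of_forall_eps`; twin of `periodicGroundStateEnergy_mul_le_maxForm_of_bound_finiteRange`);
* `stub_pairFinal` — the bound for every `η` (Lipschitz clamp truncations `clampC k ∘ η`, whose energies are
  dominated by those of `η`, and dominated convergence of the norms; twin of
  `periodicGroundStateEnergy_mul_le_maxForm_finiteRange`).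

Tagged folklore; cite [ReedSimonIV1978] Thm. XIII.64 (B. Simon, J. Operator Theory 1 (1979) 37–47, Thm. 2.1) for
the variational principle behind it.
-/

noncomputable section

namespace Summit.AtomisticToContinuum.BoseEinsteinCondensation.Cruxes.TorusHalfSwapOverlap.TruncationSplit

open MeasureTheory Filter Topology UnitAddTorus
open scoped ENNReal NNReal InnerProductSpace
open Literature.MathematicalPhysics.QuantumManyBody.BoseGas
open Literature.Analysis.FunctionSpaces Literature.Analysis.OperatorTheory
open Summit.AtomisticToContinuum.BoseEinsteinCondensation.AbsTorus

-- The measure on `ℝ/ℤ` is the Haar PROBABILITY measure, as in `PeriodicFormDomain.lean`.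
attribute [local instance] formDomain_measureSpace formDomain_isProbabilityMeasure formDomain_isProbabilityMeasure_pi

/-- Local notation for the Hilbert space `H = L²((ℝ/ℤ)^{3N})`. -/
local notation "L2T " N':max => Lp ℂ 2 (volume : Measure (UnitAddTorus (Fin N' × Fin 3)))

variable {N : ℕ} {L : ℝ}

/-! ### Bounded finite-energy classes have pair-profile hard-layer decay -/

/-- **Bounded finite-energy classes have pair-profile hard-layer decay.** Under Z (`hZ`, the pair-profile
hard-layer decay of essentially bounded functions with ACL line representatives of locally finite line energy):
for `L > 0`, a symmetric matrix `V` of repulsive finite-range profiles, and `ζ ∈ L²((ℝ/ℤ)^{3N})` essentially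
bounded with finite kinetic and potential maximal-form energy,
`∫_{fromUnitTorusN L ⁻¹' hardLayerP V L s} |ζ|² = o(s²)`. [folklore] -/
theorem pairFinal_hardLayerP_decay_of_bound
    (hZ : ∀ (N : ℕ) (L : ℝ), 0 < L → ∀ V : Fin N → Fin N → ℝ → ℝ≥0∞, (∀ i j, V i j = V j i) →
      (∀ i j, Measurable (V i j)) → ∀ R₀ : ℝ, (∀ i j, ∀ b ∈ hardRad (V i j), b ≤ R₀) →
      ∀ (η : UnitAddTorus (Fin N × Fin 3) → ℂ) (G H : Fin N × Fin 3 → UnitAddTorus (Fin N × Fin 3) → ℂ),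
        (∀ q, G q =ᵐ[volume] η) → (∀ q, Measurable (H q)) → (∀ q, ∫⁻ t, ‖H q t‖ₑ ^ 2 ≠ ⊤) →
        (∀ q : Fin N × Fin 3, ∀ᵐ t ∂(volume : Measure (UnitAddTorus (Fin N × Fin 3))),
        (∀ a b : ℝ, IntervalIntegrable (fun x : ℝ => H q (t + Pi.single q ((x : ℝ) : UnitAddCircle))) volume a b ∧
          G q (t + Pi.single q ((b : ℝ) : UnitAddCircle)) - G q (t + Pi.single q ((a : ℝ) : UnitAddCircle)) =
            ∫ x in a..b, H q (t + Pi.single q ((x : ℝ) : UnitAddCircle))) ∧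
        (∀ a b : ℝ, ∫⁻ x in Set.Ioo a b, pairInteraction V L
          (fromUnitTorusN L (t + Pi.single q ((x : ℝ) : UnitAddCircle))) *
            ‖G q (t + Pi.single q ((x : ℝ) : UnitAddCircle))‖ₑ ^ 2 ≠ ⊤)) →
        ∀ k : ℝ, (∀ᵐ t ∂(volume : Measure (UnitAddTorus (Fin N × Fin 3))), ‖η t‖ ≤ k) →
        ∀ ε : ℝ, 0 < ε → ∃ s₀ : ℝ, 0 < s₀ ∧ ∀ s : ℝ, 0 < s → s ≤ s₀ →
          ∫⁻ t in fromUnitTorusN L ⁻¹' hardLayerP V L s, ‖η t‖ₑ ^ 2 ≤ ENNReal.ofReal (ε * s ^ 2))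
    (hL : 0 < L) {V : Fin N → Fin N → ℝ → ℝ≥0∞} (hVs : ∀ i j, V i j = V j i)
    (hV : ∀ i j, IsRepulsiveFiniteRange (V i j)) (ζ : L2T N) {k : ℝ}
    (hbound : ∀ᵐ t ∂(volume : Measure (UnitAddTorus (Fin N × Fin 3))), ‖(ζ : UnitAddTorus (Fin N × Fin 3) → ℂ) t‖ ≤ k)
    (hK : maxFormKin L ζ ≠ ⊤) (hP : maxFormPotW (pairInteraction V L) L ζ ≠ ⊤) {ε' : ℝ} (hε' : 0 < ε') :
    ∃ s₀ : ℝ, 0 < s₀ ∧ ∀ s : ℝ, 0 < s → s ≤ s₀ →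
      ∫⁻ t in fromUnitTorusN L ⁻¹' hardLayerP V L s,
        ((‖(ζ : UnitAddTorus (Fin N × Fin 3) → ℂ) t‖₊ : ℝ≥0∞)) ^ 2 ≤ ENNReal.ofReal (ε' * s ^ 2) := by
  unfold maxFormKin at hK
  unfold maxFormPotW at hP
  set η : UnitAddTorus (Fin N × Fin 3) → ℂ := (ζ : UnitAddTorus (Fin N × Fin 3) → ℂ) with hη
  have hηm : Measurable η := (Lp.stronglyMeasurable ζ).measurable
  have hηmem : MemLp η 2 volume := Lp.memLp ζ
  have hVm : ∀ i j, Measurable (V i j) := fun i j => (hV i j).1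
  -- the ACL representatives, one for each coordinate
  have hKq : ∀ q : Fin N × Fin 3,
      ∑' n : Fin N × Fin 3 → ℤ, ENNReal.ofReal ((n q : ℝ) ^ 2) * ‖mFourierCoeff η n‖ₑ ^ 2 ≠ ⊤ := fun q =>
    ne_top_of_le_ne_top (ENNReal.mul_ne_top ENNReal.ofReal_ne_top hK) (tsum_sq_coord_le_kinetic hL ζ q)
  choose G H hGm hHm hGη hHmem _hHcoef hACL using
    fun q : Fin N × Fin 3 => Torus.exists_lineACL_repr q hηm hηmem (hKq q)
  have hHfin : ∀ q, ∫⁻ t, ‖H q t‖ₑ ^ 2 ≠ ⊤ := fun q => by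
    have h := lintegral_rpow_enorm_lt_top_of_eLpNorm_lt_top two_ne_zero ENNReal.ofNat_ne_top
      (hHmem q).eLpNorm_lt_top
    simp only [ENNReal.toReal_ofNat, ENNReal.rpow_two] at h
    exact h.ne
  -- the line potential energy is locally finite on almost every line
  have hWm : Measurable fun t : UnitAddTorus (Fin N × Fin 3) => pairInteraction V L (fromUnitTorusN L t) :=
    (measurable_pairInteraction hVm L).comp (measurable_fromUnitTorusN L)
  have hgood : ∀ q : Fin N × Fin 3, ∀ᵐ t ∂(volume : Measure (UnitAddTorus (Fin N × Fin 3))),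
      (∀ a b : ℝ, IntervalIntegrable (fun x : ℝ => H q (t + Pi.single q ((x : ℝ) : UnitAddCircle))) volume a b ∧
        G q (t + Pi.single q ((b : ℝ) : UnitAddCircle)) - G q (t + Pi.single q ((a : ℝ) : UnitAddCircle)) =
          ∫ x in a..b, H q (t + Pi.single q ((x : ℝ) : UnitAddCircle))) ∧
      (∀ a b : ℝ, ∫⁻ x in Set.Ioo a b, pairInteraction V L
        (fromUnitTorusN L (t + Pi.single q ((x : ℝ) : UnitAddCircle))) *
          ‖G q (t + Pi.single q ((x : ℝ) : UnitAddCircle))‖ₑ ^ 2 ≠ ⊤) := by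
    intro q
    have hΦm : Measurable fun t => pairInteraction V L (fromUnitTorusN L t) * ‖G q t‖ₑ ^ 2 :=
      hWm.mul ((hGm q).enorm.pow_const 2)
    have hΦfin : ∫⁻ t, pairInteraction V L (fromUnitTorusN L t) * ‖G q t‖ₑ ^ 2 ≠ ⊤ := by
      rw [lintegral_congr_ae ((hGη q).mono fun t ht =>
        show pairInteraction V L (fromUnitTorusN L t) * ‖G q t‖ₑ ^ 2 =
          pairInteraction V L (fromUnitTorusN L t) * ‖η t‖ₑ ^ 2 by rw [ht])]
      simpa only [enorm_eq_nnnorm] using hP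
    filter_upwards [hACL q, Torus.ae_lintegral_line_lt_top q hΦm hΦfin] with t ht hfin
    refine ⟨ht, fun a b => ?_⟩
    obtain ⟨M, hM⟩ := exists_nat_ge (max |a| |b|)
    refine (lt_of_le_of_lt (lintegral_mono_set fun x hx => ?_) (hfin M)).ne
    have ha : |a| ≤ M := (le_max_left _ _).trans hM
    have hb : |b| ≤ M := (le_max_right _ _).trans hM
    exact ⟨by linarith [hx.1, neg_abs_le a], by linarith [hx.2, le_abs_self b]⟩
  -- a common range bound for the hard radii of all pairs
  choose R hR using fun i j => (hV i j).2
  have hSR : ∀ i j, ∀ b ∈ hardRad (V i j), b ≤ ∑ i' : Fin N, ∑ j' : Fin N, |R i' j'| := fun i j b hb =>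
    calc b ≤ R i j := le_of_mem_hardRad (hR i j) hb
      _ ≤ |R i j| := le_abs_self _
      _ ≤ ∑ j' : Fin N, |R i j'| :=
          Finset.single_le_sum (f := fun j' => |R i j'|) (fun _ _ => abs_nonneg _) (Finset.mem_univ j)
      _ ≤ ∑ i' : Fin N, ∑ j' : Fin N, |R i' j'| :=
          Finset.single_le_sum (f := fun i' => ∑ j' : Fin N, |R i' j'|)
            (fun _ _ => Finset.sum_nonneg fun _ _ => abs_nonneg _) (Finset.mem_univ i)
  obtain ⟨s₀, hs₀, h⟩ := hZ N L hL V hVs hVm _ hSR η G H hGη hHm hHfin hgood k hbound ε' hε'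
  exact ⟨s₀, hs₀, fun s hs hss₀ => by simpa only [hη, enorm_eq_nnnorm] using h s hs hss₀⟩

/-! ### The pair-profile maximal-form bound -/

/-- **The pair-profile hard-core maximal-form bound for bounded classes.** Under Z (`hZ`, hard-layer decay) and
S (`hS`, the cut-off step): for `L > 0`, a symmetric matrix `V` of repulsive finite-range profiles, and
`ζ ∈ L²((ℝ/ℤ)^{3N})` essentially bounded,
`absGroundStateEnergyW (pairInteraction V L) L · ‖ζ‖² ≤ maxFormW (pairInteraction V L) L ζ` (trivial if the maximal
form is infinite; otherwise `ζ` has hard-layer decay, S applies for every `ε > 0`, and `ε → 0`).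
[cite: ReedSimonIV1978, Thm. XIII.64] -/
theorem pairFinal_mul_le_maxFormW_of_bound
    (hZ : ∀ (N : ℕ) (L : ℝ), 0 < L → ∀ V : Fin N → Fin N → ℝ → ℝ≥0∞, (∀ i j, V i j = V j i) →
      (∀ i j, Measurable (V i j)) → ∀ R₀ : ℝ, (∀ i j, ∀ b ∈ hardRad (V i j), b ≤ R₀) →
      ∀ (η : UnitAddTorus (Fin N × Fin 3) → ℂ) (G H : Fin N × Fin 3 → UnitAddTorus (Fin N × Fin 3) → ℂ),
        (∀ q, G q =ᵐ[volume] η) → (∀ q, Measurable (H q)) → (∀ q, ∫⁻ t, ‖H q t‖ₑ ^ 2 ≠ ⊤) →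
        (∀ q : Fin N × Fin 3, ∀ᵐ t ∂(volume : Measure (UnitAddTorus (Fin N × Fin 3))),
        (∀ a b : ℝ, IntervalIntegrable (fun x : ℝ => H q (t + Pi.single q ((x : ℝ) : UnitAddCircle))) volume a b ∧
          G q (t + Pi.single q ((b : ℝ) : UnitAddCircle)) - G q (t + Pi.single q ((a : ℝ) : UnitAddCircle)) =
            ∫ x in a..b, H q (t + Pi.single q ((x : ℝ) : UnitAddCircle))) ∧
        (∀ a b : ℝ, ∫⁻ x in Set.Ioo a b, pairInteraction V L
          (fromUnitTorusN L (t + Pi.single q ((x : ℝ) : UnitAddCircle))) *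
            ‖G q (t + Pi.single q ((x : ℝ) : UnitAddCircle))‖ₑ ^ 2 ≠ ⊤)) →
        ∀ k : ℝ, (∀ᵐ t ∂(volume : Measure (UnitAddTorus (Fin N × Fin 3))), ‖η t‖ ≤ k) →
        ∀ ε : ℝ, 0 < ε → ∃ s₀ : ℝ, 0 < s₀ ∧ ∀ s : ℝ, 0 < s → s ≤ s₀ →
          ∫⁻ t in fromUnitTorusN L ⁻¹' hardLayerP V L s, ‖η t‖ₑ ^ 2 ≤ ENNReal.ofReal (ε * s ^ 2))
    (hS : ∀ (N : ℕ) (L : ℝ), 0 < L → ∀ V : Fin N → Fin N → ℝ → ℝ≥0∞, (∀ i j, V i j = V j i) →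
      (∀ i j, IsRepulsiveFiniteRange (V i j)) →
      ∀ (ζ : Lp ℂ 2 (volume : Measure (UnitAddTorus (Fin N × Fin 3)))) (k : ℝ),
        (∀ᵐ t ∂(volume : Measure (UnitAddTorus (Fin N × Fin 3))), ‖(ζ : UnitAddTorus (Fin N × Fin 3) → ℂ) t‖ ≤ k) →
        (∀ ε' : ℝ, 0 < ε' → ∃ s₀ : ℝ, 0 < s₀ ∧ ∀ s : ℝ, 0 < s → s ≤ s₀ →
          ∫⁻ t in fromUnitTorusN L ⁻¹' hardLayerP V L s,
            ((‖(ζ : UnitAddTorus (Fin N × Fin 3) → ℂ) t‖₊ : ℝ≥0∞)) ^ 2 ≤ ENNReal.ofReal (ε' * s ^ 2)) →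
        ∀ ε : ℝ, 0 < ε →
          absGroundStateEnergyW (pairInteraction V L) L * ENNReal.ofReal (‖ζ‖ ^ 2 - ε) ≤
            ENNReal.ofReal (1 + ε) * maxFormW (pairInteraction V L) L ζ + ENNReal.ofReal ε)
    (hL : 0 < L) {V : Fin N → Fin N → ℝ → ℝ≥0∞} (hVs : ∀ i j, V i j = V j i)
    (hV : ∀ i j, IsRepulsiveFiniteRange (V i j)) (ζ : L2T N) {k : ℝ}
    (hbound : ∀ᵐ t ∂(volume : Measure (UnitAddTorus (Fin N × Fin 3))), ‖(ζ : UnitAddTorus (Fin N × Fin 3) → ℂ) t‖ ≤ k) :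
    absGroundStateEnergyW (pairInteraction V L) L * ENNReal.ofReal (‖ζ‖ ^ 2) ≤ maxFormW (pairInteraction V L) L ζ := by
  by_cases hQ : maxFormW (pairInteraction V L) L ζ = ⊤
  · rw [hQ]; exact le_top
  have hQ' : maxFormKin L ζ ≠ ⊤ ∧ maxFormPotW (pairInteraction V L) L ζ ≠ ⊤ := by
    rw [maxFormW_def, ENNReal.add_eq_top, not_or] at hQ
    exact hQ
  exact HardLayerAux.mul_ofReal_le_of_forall_eps hQ fun ε hε _ =>
    hS N L hL V hVs hV ζ k hbound
      (fun ε' hε' => pairFinal_hardLayerP_decay_of_bound hZ hL hVs hV ζ hbound hQ'.1 hQ'.2 hε') ε hε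

/-- **Stub F: the pair-profile hard-core maximal-form bound on the absolute class, from Z and S.** Given the
registered statements of Z (pair-profile hard-layer decay `o(s²)` for essentially bounded functions with ACL line
representatives) and S (the pair-profile cut-off step for essentially bounded classes with hard-layer decay): for
every `N`, `L > 0`, every symmetric matrix `V` of repulsive finite-range pair profiles (hard cores allowed pair by
pair) and EVERY `η ∈ L²((ℝ/ℤ)^{3N})`,
`absGroundStateEnergyW (pairInteraction V L) L · ‖η‖² ≤ maxFormW (pairInteraction V L) L η` — the Lipschitz clamp
truncations `clampC k ∘ η` are essentially bounded with energies dominated by those of `η`, the bounded case applies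
to each, and `‖clampC k ∘ η‖ → ‖η‖` by dominated convergence. [cite: ReedSimonIV1978, Thm. XIII.64] -/
theorem stub_pairFinal :
    (∀ (N : ℕ) (L : ℝ), 0 < L → ∀ V : Fin N → Fin N → ℝ → ℝ≥0∞, (∀ i j, V i j = V j i) →
      (∀ i j, Measurable (V i j)) → ∀ R₀ : ℝ, (∀ i j, ∀ b ∈ hardRad (V i j), b ≤ R₀) →
      ∀ (η : UnitAddTorus (Fin N × Fin 3) → ℂ) (G H : Fin N × Fin 3 → UnitAddTorus (Fin N × Fin 3) → ℂ),
        (∀ q, G q =ᵐ[volume] η) → (∀ q, Measurable (H q)) → (∀ q, ∫⁻ t, ‖H q t‖ₑ ^ 2 ≠ ⊤) →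
        (∀ q : Fin N × Fin 3, ∀ᵐ t ∂(volume : Measure (UnitAddTorus (Fin N × Fin 3))),
        (∀ a b : ℝ, IntervalIntegrable (fun x : ℝ => H q (t + Pi.single q ((x : ℝ) : UnitAddCircle))) volume a b ∧
          G q (t + Pi.single q ((b : ℝ) : UnitAddCircle)) - G q (t + Pi.single q ((a : ℝ) : UnitAddCircle)) =
            ∫ x in a..b, H q (t + Pi.single q ((x : ℝ) : UnitAddCircle))) ∧
        (∀ a b : ℝ, ∫⁻ x in Set.Ioo a b, pairInteraction V L
          (fromUnitTorusN L (t + Pi.single q ((x : ℝ) : UnitAddCircle))) *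
            ‖G q (t + Pi.single q ((x : ℝ) : UnitAddCircle))‖ₑ ^ 2 ≠ ⊤)) →
        ∀ k : ℝ, (∀ᵐ t ∂(volume : Measure (UnitAddTorus (Fin N × Fin 3))), ‖η t‖ ≤ k) →
        ∀ ε : ℝ, 0 < ε → ∃ s₀ : ℝ, 0 < s₀ ∧ ∀ s : ℝ, 0 < s → s ≤ s₀ →
          ∫⁻ t in fromUnitTorusN L ⁻¹' hardLayerP V L s, ‖η t‖ₑ ^ 2 ≤ ENNReal.ofReal (ε * s ^ 2)) →
    (∀ (N : ℕ) (L : ℝ), 0 < L → ∀ V : Fin N → Fin N → ℝ → ℝ≥0∞, (∀ i j, V i j = V j i) →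
      (∀ i j, IsRepulsiveFiniteRange (V i j)) →
      ∀ (ζ : Lp ℂ 2 (volume : Measure (UnitAddTorus (Fin N × Fin 3)))) (k : ℝ),
        (∀ᵐ t ∂(volume : Measure (UnitAddTorus (Fin N × Fin 3))), ‖(ζ : UnitAddTorus (Fin N × Fin 3) → ℂ) t‖ ≤ k) →
        (∀ ε' : ℝ, 0 < ε' → ∃ s₀ : ℝ, 0 < s₀ ∧ ∀ s : ℝ, 0 < s → s ≤ s₀ →
          ∫⁻ t in fromUnitTorusN L ⁻¹' hardLayerP V L s,
            ((‖(ζ : UnitAddTorus (Fin N × Fin 3) → ℂ) t‖₊ : ℝ≥0∞)) ^ 2 ≤ ENNReal.ofReal (ε' * s ^ 2)) →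
        ∀ ε : ℝ, 0 < ε →
          absGroundStateEnergyW (pairInteraction V L) L * ENNReal.ofReal (‖ζ‖ ^ 2 - ε) ≤
            ENNReal.ofReal (1 + ε) * maxFormW (pairInteraction V L) L ζ + ENNReal.ofReal ε) →
    ∀ (N : ℕ) (L : ℝ), 0 < L → ∀ V : Fin N → Fin N → ℝ → ℝ≥0∞, (∀ i j, V i j = V j i) →
      (∀ i j, IsRepulsiveFiniteRange (V i j)) →
      ∀ η : Lp ℂ 2 (volume : Measure (UnitAddTorus (Fin N × Fin 3))),
        absGroundStateEnergyW (pairInteraction V L) L * ENNReal.ofReal (‖η‖ ^ 2) ≤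
          maxFormW (pairInteraction V L) L η := by
  intro hZ hS N L hL V hVs hV η
  set f : ℕ → L2T N := fun k => (lipschitzWith_clampC (k : ℝ)).compLp (clampC_zero (Nat.cast_nonneg k)) η
  -- the bounded case for each truncation, whose energies are dominated by those of `η`
  have hk : ∀ k : ℕ, absGroundStateEnergyW (pairInteraction V L) L * ENNReal.ofReal (‖f k‖ ^ 2) ≤
      maxFormW (pairInteraction V L) L η := fun k => by
    refine (pairFinal_mul_le_maxFormW_of_bound hZ hS hL hVs hV (f k) (ae_norm_clampLp_le η k)).trans ?_
    rw [maxFormW_def, maxFormW_def]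
    exact add_le_add (tsum_kinetic_clampLp_le η k)
      (lintegral_pot_clampLp_le η k fun t => pairInteraction V L (fromUnitTorusN L t))
  -- `‖f k‖² → ‖η‖²` as `ℝ≥0∞`-integrals
  have hnorm : ∀ x : L2T N, ENNReal.ofReal (‖x‖ ^ 2) =
      ∫⁻ t, ((‖(x : UnitAddTorus (Fin N × Fin 3) → ℂ) t‖₊ : ℝ≥0∞)) ^ 2 := fun x => by
    rw [(norm_Lp_two_sq_eq_toReal x).1, ENNReal.ofReal_toReal (norm_Lp_two_sq_eq_toReal x).2]
  simp only [hnorm] at hk ⊢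
  by_cases h0 : ∫⁻ t, ((‖(η : UnitAddTorus (Fin N × Fin 3) → ℂ) t‖₊ : ℝ≥0∞)) ^ 2 = 0
  · rw [h0, mul_zero]
    exact zero_le
  have hlim := ENNReal.Tendsto.const_mul (tendsto_lintegral_clampLp_sq η) (Or.inl h0)
    (a := absGroundStateEnergyW (pairInteraction V L) L)
  exact le_of_tendsto' hlim hk

end Summit.AtomisticToContinuum.BoseEinsteinCondensation.Cruxes.TorusHalfSwapOverlap.TruncationSplit

end
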